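import Summits.HodgeConjecture.HodgeConjecture.Theorems.Ring2HypothesesDescentAbsoluteExteriorLefschetzH1
import HarnessLib

/-!
# Ring 2 — hypotheses layer, descent axis: MILNE'S CRITERION READ IN `GL(H¹(A(ℂ); ℂ))` — «no exotic class on any power of `A`»
# ⟺ «`U(C(A) ⊗ ℂ, †) ≤ G|_{H¹}`», for each group `G` of the tower `Hg ≤ G¹_AH ≤ G¹_mot ≤ G¹_alg ≤ S(A)`

HONEST FRAMING (page 1, verbatim the cell's standing line): **research route conditional on HC_CM; not a
corollary; Q11.4-sentence-2 already refuted in dim ≥ 3.** Nothing in this file proves a case of the Hodge conjecture that the tree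
did not have; nothing discharges the binder of record b06 `Ring2.Hypotheses.AbsoluteHodgeImpliesAlgebraicAV` («absolute Hodge
classes on complex abelian varieties are algebraic», `Ring2HypothesesDescent.lean` :73; OPEN); the binder table's numbers do not
move. `HC_CM` (`Theses.RankFourFaces.CMAbelianHodge`), `HC_AV` and row b06 do not occur; `HodgeConjectureFor` and Charles–Schnell
11.2.18 (`AbsoluteHodgeClassesAreAlgebraicFor`) occur AT the powers `A^{a+1}` as CONCLUSIONS under an explicit hypothesis on `A` read
in `GL(H¹(A(ℂ); ℂ))`. Hodge ladder STAGE 3, `BINDER-OWNERS.md` row **b06**, seat `ring2-b06` (gen 85); closing file of the gen.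

THE POINT. With «`S(A)` acts through `H¹`» (`…ExteriorLefschetzH1`, same gen: `g ↦ g₁` is a bijection
`S(A) → S(A)(ℂ) = U(C(A) ⊗ ℂ, †_h) = Milne1999.unitaryCentralizerGroup A h`, and subgroups `K ≤ S(A)` satisfy
`S(A) ≤ K ⟺ U ≤ K|_{H¹}`) and Milne's criterion on all powers (`…ExteriorPowers` and the Literature's
`Milne1999/SpecialLefschetzGroupInvariantsPowers`, same gen: `S(A) ≤ Stab(T) ⟺ T ⊆ Lefschetz`), each «classes of kind `T` on every
power of `A` are Lefschetz» statement becomes a statement about ONE subgroup of `GL_{2g}(ℂ) = GL(H¹(A(ℂ); ℂ))` — the group in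
which the cell's Hodge-side seats compute (`VanGeemen1994.hodgeGroupOne`, `HasHodgeGroupSU`, gen 84's `tower_map_evalOne`):

* §K1 **Milne Prop. 4.8 (a) ⟺ (c) IN `GL(H¹)`, FACT-FREE**: no power of `A` supports an exotic Hodge class
  (`∀ a, IsDivisorGenerated (A.powSucc a)`, i.e. `IsStablyNondegenerate A`) **iff `U(C(A) ⊗ ℂ, †_h) ≤ Hg(A)(ℂ)|_{H¹}`**
  (`VanGeemen1994.hodgeGroupOne`) iff `Hg(A)(ℂ)|_{H¹} = U(C(A) ⊗ ℂ, †_h)`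
  (`forall_isDivisorGenerated_powSucc_iff_unitaryCentralizerGroup_le_hodgeGroupOne`, `…_iff_hodgeGroupOne_eq`; the Milne lane had
  `⟹` only, `hodgeGroupOne_eq_unitaryCentralizerGroup_of_forall_isDivisorGenerated'`); hence **HC and 11.2.18 for EVERY POWER of
  `A` from the single inclusion `U(C(A) ⊗ ℂ, †_h) ≤ Hg(A)(ℂ)|_{H¹}`** (`hodgeConjectureFor_powSucc_of_…`,
  `absoluteHodgeClassesAreAlgebraicFor_powSucc_of_…`), fact-free.
* §K2 `G¹_alg`: every algebraic class on every power is Lefschetz ⟺ `U ≤ G¹_alg(A)|_{H¹}` (fact-free); §K3 `G¹_mot`: every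
  motivated class on every power is Lefschetz ⟺ `U ≤ G¹_mot(A)|_{H¹}` (fact-free); §K4 `G¹_AH`: every absolute Hodge class on every
  power is Lefschetz ⟺ `U ≤ G¹_AH(A)|_{H¹}` (mod V-B3 = c23) — so **gen 84's §L4 hypothesis gives 11.2.18 on ALL powers**, not only
  on `A` (`absoluteHodgeClassesAreAlgebraicFor_powSucc_of_unitaryCentralizerGroup_le_map`, mod c23).

HONEST COLUMN. No definition, no named fact, no sorry; nothing of the cell is discharged; c23 displayed in §K4 only. Mod c1
(`G¹_AH = Hg`) §K4 is §K1. NOT obtained: anything deciding the row. PRESEARCH: as in the companions (Milne 1999 §4 Thm. 4.4,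
Cor. 4.5, Cor. 4.7, Prop. 4.8 [corpus: paper:doi-10-1215-s0012-7094-99-09620-5 pp. 659–660]; van Geemen LNM 1594 6.4–6.7); assembly, no
novelty claimed. References (bib keys): Milne1999LefschetzClasses (§4 Thm. 4.4, Cor. 4.5, Cor. 4.7, Prop. 4.8, Rem. 4.9),
vanGeemen1994HodgeAV (§2.4–2.5, 6.4–6.7), Gordon1999HodgeAVSurvey (Thm. 7.5, Def. 7.6), Andre1996Motifs (§4.6 (ii)),
Deligne1982HodgeCycles (§2 Ex. 2.1 (a), I §3 Thm. 3.8), CharlesSchnell2014Notes (§11.2.5 (11.2.18)).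
-/

noncomputable section

-- every declaration of this problem lives in `Summit.HodgeConjecture.HodgeConjecture.…` (summit = sub-problem)
set_option linter.dupNamespace false

namespace Summit.HodgeConjecture.HodgeConjecture.Ring2.Hypotheses

open CategoryTheory AlgebraicGeometry MonoidalCategory CartesianMonoidalCategory
open Literature.AlgebraicGeometry Literature.AlgebraicGeometry.Motives
open Literature.AlgebraicGeometry.HodgeTheory
open Literature.AlgebraicTopology.SingularHomology
open Literature.AlgebraicGeometry.VanGeemen1994 (hodgeGroupOne)
open Literature.AlgebraicGeometry.Milne1999 (specialLefschetzGroup lefschetzPowClasses unitaryCentralizerGroup)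

variable (A : AbelianVariety ℂ) {h : complexBetti A.X 2}

/-! ## §K1 Milne Prop. 4.8 in `GL(H¹)`: stable nondegeneracy ⟺ `U(C(A) ⊗ ℂ, †) ≤ Hg(A)|_{H¹}` -/

/-- **MILNE PROP. 4.8 (a) ⟺ (c) READ IN `GL(H¹(A(ℂ); ℂ))` — FACT-FREE.** For a complex abelian variety `A` and a polarization class `h`
(rational, `s · h` Kähler, `s > 0`): no power `A^{a+1}` supports an exotic Hodge class (`IsDivisorGenerated (A.powSucc a)` for all `a`)
**iff every automorphism of `H¹(A(ℂ); ℂ)` commuting with `End(A)` and preserving `Q_h` is the `H¹`-component of an element of the Hodge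
group**: `unitaryCentralizerGroup A h ≤ hodgeGroupOne (dim A) A.X`. (`Hg ≤ S(A)`, `S(A)` injects into `GL(H¹)` with image `U`, and
Prop. 4.8 on all powers.) [cite: Milne1999LefschetzClasses, Prop. 4.8 (p. 660) and Thm. 4.4 (p. 659)] [cite: vanGeemen1994HodgeAV, 6.4–6.7] -/
theorem forall_isDivisorGenerated_powSucc_iff_unitaryCentralizerGroup_le_hodgeGroupOne (hQ : IsRationalClass h)
    (hK : ∃ s : ℝ, 0 < s ∧ IsKaehlerClass A.dim A.X ((s : ℂ) • h)) :
    (∀ a, IsDivisorGenerated (A.powSucc a)) ↔ unitaryCentralizerGroup A h ≤ hodgeGroupOne A.dim A.X := by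
  rw [← A.hodgeGroup_eq_specialLefschetzGroup_iff_forall_isDivisorGenerated, hodgeGroupOne,
    ← specialLefschetzGroup_le_iff_unitaryCentralizerGroup_le_map A hQ hK A.hodgeGroup_le_specialLefschetzGroup.1]
  exact ⟨fun e ↦ e.ge, fun e ↦ le_antisymm A.hodgeGroup_le_specialLefschetzGroup.1 e⟩

/-- **… iff `Hg(A)(ℂ)|_{H¹} = U(C(A) ⊗ ℂ, †_h)`** (the lane's `hodgeGroupOne_eq_unitaryCentralizerGroup_of_forall_isDivisorGenerated'`
is `⟹`). [cite: Milne1999LefschetzClasses, Prop. 4.8 (p. 660) and Thm. 4.4 (p. 659)] -/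
theorem forall_isDivisorGenerated_powSucc_iff_hodgeGroupOne_eq (hQ : IsRationalClass h)
    (hK : ∃ s : ℝ, 0 < s ∧ IsKaehlerClass A.dim A.X ((s : ℂ) • h)) :
    (∀ a, IsDivisorGenerated (A.powSucc a)) ↔ hodgeGroupOne A.dim A.X = unitaryCentralizerGroup A h :=
  ⟨Milne1999.hodgeGroupOne_eq_unitaryCentralizerGroup_of_forall_isDivisorGenerated' hQ hK,
    fun e ↦ (forall_isDivisorGenerated_powSucc_iff_unitaryCentralizerGroup_le_hodgeGroupOne A hQ hK).2 e.ge⟩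

/-- **HC FOR EVERY POWER OF `A` FROM ONE INCLUSION IN `GL(H¹)`** — FACT-FREE: if `U(C(A) ⊗ ℂ, †_h) ≤ Hg(A)(ℂ)|_{H¹}` then every power
`A^{a+1}` satisfies the Hodge conjecture (its Hodge classes are Lefschetz; Lefschetz `(1,1)` and cup products).
[cite: Milne1999LefschetzClasses, Prop. 4.8 (p. 660)] [cite: vanGeemen1994HodgeAV, §2.4] -/
theorem hodgeConjectureFor_powSucc_of_unitaryCentralizerGroup_le_hodgeGroupOne (hQ : IsRationalClass h)
    (hK : ∃ s : ℝ, 0 < s ∧ IsKaehlerClass A.dim A.X ((s : ℂ) • h)) (hle : unitaryCentralizerGroup A h ≤ hodgeGroupOne A.dim A.X)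
    (a : ℕ) : HodgeConjectureFor (A.powSucc a).dim (A.powSucc a).X :=
  hodgeConjectureFor_of_isDivisorGenerated _
    ((forall_isDivisorGenerated_powSucc_iff_unitaryCentralizerGroup_le_hodgeGroupOne A hQ hK).2 hle a)

/-- **11.2.18 for every power of `A` from the same inclusion** — FACT-FREE (`Hg = S`, then `…ExteriorPowers`).
[cite: Milne1999LefschetzClasses, Prop. 4.8 (p. 660)] [cite: CharlesSchnell2014Notes, §11.2.5 (11.2.18)] -/
theorem absoluteHodgeClassesAreAlgebraicFor_powSucc_of_unitaryCentralizerGroup_le_hodgeGroupOne (hQ : IsRationalClass h)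
    (hK : ∃ s : ℝ, 0 < s ∧ IsKaehlerClass A.dim A.X ((s : ℂ) • h)) (hle : unitaryCentralizerGroup A h ≤ hodgeGroupOne A.dim A.X)
    (a : ℕ) : AbsoluteHodgeClassesAreAlgebraicFor (A.powSucc a).dim (A.powSucc a).X :=
  absoluteHodgeClassesAreAlgebraicFor_powSucc_of_hodgeGroup_eq_specialLefschetzGroup A
    (A.hodgeGroup_eq_specialLefschetzGroup_of_forall_isDivisorGenerated
      ((forall_isDivisorGenerated_powSucc_iff_unitaryCentralizerGroup_le_hodgeGroupOne A hQ hK).2 hle)) a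

/-! ## §K2–§K4 The other groups of the tower, read in `GL(H¹)` -/

/-- **`G¹_alg`**: every algebraic class on every power of `A` is a Lefschetz class iff `U(C(A) ⊗ ℂ, †_h) ≤ G¹_alg(A)(ℂ)|_{H¹}` — FACT-FREE.
[cite: Milne1999LefschetzClasses, Thm. 4.4 and Prop. 4.8] [cite: Andre1996Motifs, §4.6 (ii) (p. 24)] -/
theorem forall_algebraicPowClasses_subset_iff_unitaryCentralizerGroup_le_map (hQ : IsRationalClass h)
    (hK : ∃ s : ℝ, 0 < s ∧ IsKaehlerClass A.dim A.X ((s : ℂ) • h)) :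
    (∀ a p, algebraicPowClasses A.X a p ⊆ lefschetzPowClasses A.dim A.X a p) ↔
      unitaryCentralizerGroup A h ≤ (algebraicStabilizer A.X).map
        (Pi.evalMonoidHom (fun k : ℕ ↦ complexBetti A.X k ≃ₗ[ℂ] complexBetti A.X k) 1) := by
  rw [← algebraicStabilizer_eq_specialLefschetzGroup_iff,
    ← specialLefschetzGroup_le_iff_unitaryCentralizerGroup_le_map A hQ hK (algebraicStabilizer_le_specialLefschetzGroup A)]
  exact ⟨fun e ↦ e.ge, fun e ↦ le_antisymm (algebraicStabilizer_le_specialLefschetzGroup A) e⟩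

/-- **`G¹_mot`**: every motivated class on every power of `A` is a Lefschetz class iff `U(C(A) ⊗ ℂ, †_h) ≤ G¹_mot(A)(ℂ)|_{H¹}` —
FACT-FREE; then b05's binder holds at every power of `A` (`…ExteriorPowers`). [cite: Milne1999LefschetzClasses, Thm. 4.4 and Prop. 4.8]
[cite: Andre1996Motifs, §4.6 (ii) (p. 24)] -/
theorem forall_motivatedPowClasses_subset_iff_unitaryCentralizerGroup_le_map (hQ : IsRationalClass h)
    (hK : ∃ s : ℝ, 0 < s ∧ IsKaehlerClass A.dim A.X ((s : ℂ) • h)) :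
    (∀ a p, motivatedPowClasses A.dim A.X a p ⊆ lefschetzPowClasses A.dim A.X a p) ↔
      unitaryCentralizerGroup A h ≤ (specialMotivatedGaloisGroup A.dim A.X).map
        (Pi.evalMonoidHom (fun k : ℕ ↦ complexBetti A.X k ≃ₗ[ℂ] complexBetti A.X k) 1) :=
  (specialMotivatedGaloisGroup_eq_specialLefschetzGroup_iff A).symm.trans
    (specialMotivatedGaloisGroup_eq_specialLefschetzGroup_iff_unitaryCentralizerGroup_le A hQ hK)

/-- **b05's binder at every power of `A` from one inclusion in `GL(H¹)`** — FACT-FREE: if `U(C(A) ⊗ ℂ, †_h) ≤ G¹_mot(A)(ℂ)|_{H¹}` then the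
motivated classes of every `A^{a+1}` are algebraic. [cite: Milne1999LefschetzClasses, Thm. 4.4, Cor. 4.5, Prop. 4.8] [cite: Andre1996Motifs, §4.6 (ii)] -/
theorem motivatedClasses_le_algebraicClasses_powSucc_of_unitaryCentralizerGroup_le_map (hQ : IsRationalClass h)
    (hK : ∃ s : ℝ, 0 < s ∧ IsKaehlerClass A.dim A.X ((s : ℂ) • h))
    (hle : unitaryCentralizerGroup A h ≤ (specialMotivatedGaloisGroup A.dim A.X).map
      (Pi.evalMonoidHom (fun k : ℕ ↦ complexBetti A.X k ≃ₗ[ℂ] complexBetti A.X k) 1)) (a p : ℕ) :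
    motivatedClasses (A.powSucc a).dim (A.powSucc a).X p ≤ algebraicClasses (A.powSucc a).X p :=
  motivatedClasses_le_algebraicClasses_powSucc_of_specialMotivatedGaloisGroup_eq
    ((specialMotivatedGaloisGroup_eq_specialLefschetzGroup_iff_unitaryCentralizerGroup_le A hQ hK).2 hle) a p

/-- **`G¹_AH`** (mod V-B3 = c23, displayed): every absolute Hodge class on every power of `A` is a Lefschetz class iff
`U(C(A) ⊗ ℂ, †_h) ≤ G¹_AH(A)(ℂ)|_{H¹}` — gen 84's §L4 hypothesis, now an EXACT price. [cite: Milne1999LefschetzClasses, Thm. 4.4, Cor. 4.5, Prop. 4.8]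
[cite: Deligne1982HodgeCycles, §2 Example 2.1 (a) and I §3 Thm. 3.8] -/
theorem forall_absoluteHodge_subset_iff_unitaryCentralizerGroup_le_map (hZ : deligne1982_cycleClass_absoluteHodge)
    (hQ : IsRationalClass h) (hK : ∃ s : ℝ, 0 < s ∧ IsKaehlerClass A.dim A.X ((s : ℂ) • h)) :
    (∀ a p, {c : complexBetti (cartesianPow A.X (a + 1)) (2 * p) |
        IsAbsoluteHodgeClass (cartesianPowDim A.dim a) (cartesianPow A.X (a + 1)) p c} ⊆ lefschetzPowClasses A.dim A.X a p) ↔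
      unitaryCentralizerGroup A h ≤ (powClassStabilizer A.X (fun a p ↦
        {c : complexBetti (cartesianPow A.X (a + 1)) (2 * p) |
          IsAbsoluteHodgeClass (cartesianPowDim A.dim a) (cartesianPow A.X (a + 1)) p c})).map
        (Pi.evalMonoidHom (fun k : ℕ ↦ complexBetti A.X k ≃ₗ[ℂ] complexBetti A.X k) 1) :=
  (specialLefschetzGroup_le_absoluteHodgeStabilizer_iff A).symm.trans
    (specialLefschetzGroup_le_absoluteHodgeStabilizer_iff_unitaryCentralizerGroup_le A hZ hQ hK)

/-- **Gen 84's §L4 hypothesis gives 11.2.18 on EVERY POWER of `A`** (mod V-B3 = c23, displayed; §L4 had it on `A` only):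
`U(C(A) ⊗ ℂ, †_h) ≤ G¹_AH(A)(ℂ)|_{H¹}` ⟹ `AbsoluteHodgeClassesAreAlgebraicFor (dim A^{a+1}) (A^{a+1}).X` for all `a`.
[cite: Milne1999LefschetzClasses, Cor. 4.5 and Cor. 4.7 (p. 659)] [cite: CharlesSchnell2014Notes, §11.2.5 (11.2.18)] -/
theorem absoluteHodgeClassesAreAlgebraicFor_powSucc_of_unitaryCentralizerGroup_le_map (hZ : deligne1982_cycleClass_absoluteHodge)
    (hQ : IsRationalClass h) (hK : ∃ s : ℝ, 0 < s ∧ IsKaehlerClass A.dim A.X ((s : ℂ) • h))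
    (hle : unitaryCentralizerGroup A h ≤ (powClassStabilizer A.X (fun a p ↦
      {c : complexBetti (cartesianPow A.X (a + 1)) (2 * p) |
        IsAbsoluteHodgeClass (cartesianPowDim A.dim a) (cartesianPow A.X (a + 1)) p c})).map
      (Pi.evalMonoidHom (fun k : ℕ ↦ complexBetti A.X k ≃ₗ[ℂ] complexBetti A.X k) 1)) (a : ℕ) :
    AbsoluteHodgeClassesAreAlgebraicFor (A.powSucc a).dim (A.powSucc a).X :=
  absoluteHodgeClassesAreAlgebraicFor_powSucc_of_specialLefschetzGroup_le
    ((specialLefschetzGroup_le_absoluteHodgeStabilizer_iff_unitaryCentralizerGroup_le A hZ hQ hK).2 hle) a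

end Summit.HodgeConjecture.HodgeConjecture.Ring2.Hypotheses

end
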